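import Summits.BirchSwinnertonDyer.BirchSwinnertonDyer.Theses.UniversalToricDescent
import Summits.BirchSwinnertonDyer.BirchSwinnertonDyer.Theorems.UniversalToricDescentToricTransportModThreeStubRatSqueeze
import Summits.BirchSwinnertonDyer.BirchSwinnertonDyer.Theorems.EisensteinPrimesBSDpOnCellCTelescopeCarrierAlgOfWitness
import Mathlib.RingTheory.Polynomial.Cyclotomic.Basic
import Mathlib.RingTheory.Polynomial.RationalRoot
import Mathlib.RingTheory.PowerSeries.Ideal
import Mathlib.RingTheory.Length
import HarnessLib

/-!
# NODE `ramified_pin_evaporation` — crux `AdditiveSplitIMCInclusionAtThree` (stmt-BirchSwinnertonDyer-20395, THE WALL, UTD)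
# crux-ideate STANDING COVER round 22 (unit cruxidea-stmt-BirchSwinnertonDyer-20395-1-g22), 2026-08-31

D-0171 NODE (`sorry` ONLY inside `stub_*`; the composition `AdditiveSplitIMCInclusionAtThree_of` concludes the crux BY NAME).

THE LEVER — THE DEFICIENT-POWER DOOR (§0, kernel-proved, pure algebra in the UFD `R₀⟦T⟧` with the prime `3`):
`g ^ e ∣ 3 ^ s · L ^ e` with `s < e`  ⟹  `g ∣ L`  (`dvd_of_pow_dvd_C_pow_mul_pow`). Reason: the `μ`-invariant
`ord_(3)` is an INTEGER, so `e·μ(g) ≤ s + e·μ(L) < e·(1 + μ(L))` forces `μ(g) ≤ μ(L)`, and the `3`-free parts satisfy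
`g₀ ^ e ∣ L₀ ^ e ⟹ g₀ ∣ L₀` (integrally closed). So the WALL `(L) ⊆ Ch·R₀⟦T⟧ = (g)` follows from ANY divisibility in which
the total `3`-adic junk is a FRACTION `s/e < 1` of a unit — not `3`-free (the rational wall 24207 is `e = 1`, junk `3^k`,
no door) and not `μ = 0` of either side.

WHERE DEFICIENT DIVISIBILITIES COME FROM (the pieces): a `Λ`-adic Euler/Kolyvagin-system divisibility run over the
totally RAMIFIED coefficient ring `𝒪_m = R₀[ζ_{3^m}]` (`e_m = φ(3^m)`), i.e. the two-variable anticyclotomic diagonal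
class of Castella–Do (arXiv:2303.06751, §§2.2–2.4; sibling card 24207 `frozen-channel-padic-pin`) with `f = f_E` FROZEN
and `3`-depleted, restricted to the `𝒪_m`-rational line `u = ζ_{3^m} - 1` of the frozen channel instead of `u = 0`:
it reads `g ∣ 3^a · C_m · φ_m · L` in `𝒪_m⟦T⟧` with the PIN `C_m` = the value of (a branch of) the BDP function at the
frozen wild character `ν_m` (`v_{π_m}(C_m) = v_{π_m}(L(ζ_{3^m}-1))`), structural junk `3^a` (Kolyvagin / Tamagawa /
Manin exponents) and interpolation fudge `φ_m`. NORMED DOWN to `R₀⟦T⟧` (`N(g) = g^{e_m}`) this is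
`g^{e_m} ∣ 3^{s_m}·unit·L^{e_m}` with `s_m = a·e_m + v_{π_m}(L(ζ_{3^m}-1)) + v_{π_m}(φ_m)`; it is DEFICIENT for
`m ≫ 0` iff `a = 0`, `μ_an(L) = 0` (then `v_{π_m}(L(ζ_{3^m}-1)) = λ(L)` is bounded: piece S2) and `v_{π_m}(φ_m) = O(1)`.
The pin need NOT be a unit (Castella–Do choose their auxiliary `β` by [Chida–Hsieh] to make it non-zero; at additive
`3` no such choice is available, and here none is needed): its valuation is `λ + O(1)` in `π_m`-units, which EVAPORATES
against `e_m → ∞`.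

PIECES: S1 `EvaporatingPinSupplyAtThree` (UNDECIDED — the arithmetic leaf; TRANSFER `C⁺`, equivalent to the WALL given
S2 ∧ S3: `evaporatingPinSupply_of_wall`), S2 `ToothLengthEventuallyBounded` (ATTACKABLE, pure algebra, TRUE: Weierstrass
preparation + `Φ_{3^m}(1+T)` Eisenstein over `R₀`), S3 `AnalyticMuZeroBDPBranchAtThree` (ATTACKABLE: Hsieh 2014 Thm. B /
Burungale 2017 for the `3`-depleted `f_E`; nearest tree handle `Hsieh2014.thmB_exists_isHsiehLFunction_coeff_norm_eq_one_unrPeriod_anyLevel`,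
route item 20456). Kernel: pick `m` with `φ(3^m) > B + n₀`, then S1–S3 give `g^{φ(3^m)} ∣ 3^s·L^{φ(3^m)}` with
`s ≤ B + n₀ < φ(3^m)`, and the door closes the wall.

Nothing here is a theorem about elliptic curves beyond compositions of landed results; BSD is not advanced by this
file. References: [Washington1997] §7.1–7.2, §13.2; Castella–Do arXiv:2303.06751 Thm. A, §5 (proof of Thm. 5.x, p. 32:
auxiliary `β` chosen by [ChHs1]); [MazurRubin2004] §§3.5, 5.2 (error terms, hypothesis (H.4) `p > 4`);
[Howard2004HeegnerKolyvagin] Thm. 2.2.10; Hsieh 2014 (Doc. Math.) Thm. B; Liu–Zhang–Zhang 2018.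
-/

set_option linter.dupNamespace false
set_option autoImplicit false

noncomputable section

open scoped Classical

open Literature.NumberTheory.EllipticCurves
open Summit.BirchSwinnertonDyer.BirchSwinnertonDyer.Theses.UniversalToricDescent
  (RationalSplitIMCInclusionAtThree AdditiveSplitIMCInclusionAtThree)
open Summit.BirchSwinnertonDyer.BirchSwinnertonDyer.Cruxes.ToricTransportModThree.RatwallThinComb
  (dvd_of_dvd_prime_pow_mul prime_C_three)
open Summit.BirchSwinnertonDyer.Rank1Residual.X11b

namespace Summit.BirchSwinnertonDyer.BirchSwinnertonDyer.Cruxes.AdditiveSplitIMCInclusionAtThree.RamifiedPinEvaporation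

/-! ## §0 Kernel algebra in `R₀⟦T⟧` (no `sorry`): the deficient-power door -/

/-- Every non-zero `g ∈ R₀⟦T⟧` splits off a MAXIMAL power of the prime `3`: `g = 3^μ·g₀` with `3 ∤ g₀`
(`R₀` is a DVR, so `R₀⟦T⟧` is a UFD; `WfDvdMonoid.max_power_factor`). Verbatim the §0 lemma of node
`mu_dominance_relative_teeth`. [Washington1997 §7.1] -/
theorem exists_eq_C_three_pow_mul_not_dvd {g : UnrSeries 3} (hg : g ≠ 0) :
    ∃ (μ : ℕ) (g₀ : UnrSeries 3),
      ¬ (PowerSeries.C ((3 : ℕ) : unrIntegers 3) : UnrSeries 3) ∣ g₀ ∧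
        g = (PowerSeries.C ((3 : ℕ) : unrIntegers 3)) ^ μ * g₀ := by
  haveI := Summit.BirchSwinnertonDyer.Rank1Residual.X2.HidaLimitAlgebra.isDiscreteValuationRing_unrIntegers (p := 3)
  exact WfDvdMonoid.max_power_factor hg prime_C_three.irreducible

/-- **THE DEFICIENT-POWER DOOR.** In the UFD `R₀⟦T⟧` (prime `3 = C 3`): if `g ^ e ∣ 3 ^ s · L ^ e` with `s < e`, then
`g ∣ L`. Proof: write `g = 3^μ g₀`, `L = 3^ν L₀` with `3 ∤ g₀, L₀`; the `3`-free parts give `g₀^e ∣ L₀^e`, hence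
`g₀ ∣ L₀` (`R₀⟦T⟧` is integrally closed); the `3`-parts give `3^{μe} ∣ 3^{s+νe}`, i.e. `μ·e ≤ s + ν·e < (ν+1)·e`,
so `μ ≤ ν` BECAUSE `μ` IS AN INTEGER. [folklore; Washington1997 §7.1 (μ-invariant), §13.2] -/
theorem dvd_of_pow_dvd_C_pow_mul_pow {g L : UnrSeries 3} {e s : ℕ} (hse : s < e)
    (h : g ^ e ∣ (PowerSeries.C ((3 : ℕ) : unrIntegers 3)) ^ s * L ^ e) : g ∣ L := by
  have hπ : Prime (PowerSeries.C ((3 : ℕ) : unrIntegers 3) : UnrSeries 3) := prime_C_three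
  have he : e ≠ 0 := by omega
  by_cases hL : L = 0
  · rw [hL]; exact dvd_zero g
  by_cases hg : g = 0
  · exfalso
    rw [hg, zero_pow he, zero_dvd_iff, mul_eq_zero] at h
    rcases h with h | h
    · exact pow_ne_zero s hπ.ne_zero h
    · exact hL ((pow_eq_zero_iff he).mp h)
  obtain ⟨μ, g₀, hg₀, rfl⟩ := exists_eq_C_three_pow_mul_not_dvd hg
  obtain ⟨ν, L₀, hL₀, rfl⟩ := exists_eq_C_three_pow_mul_not_dvd hL
  -- normal form of the hypothesis
  have h1 : (PowerSeries.C ((3 : ℕ) : unrIntegers 3)) ^ (μ * e) * g₀ ^ e ∣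
      (PowerSeries.C ((3 : ℕ) : unrIntegers 3)) ^ (s + ν * e) * L₀ ^ e := by
    have e1 : ((PowerSeries.C ((3 : ℕ) : unrIntegers 3)) ^ μ * g₀) ^ e =
        (PowerSeries.C ((3 : ℕ) : unrIntegers 3)) ^ (μ * e) * g₀ ^ e := by
      rw [mul_pow, ← pow_mul]
    have e2 : (PowerSeries.C ((3 : ℕ) : unrIntegers 3)) ^ s * ((PowerSeries.C ((3 : ℕ) : unrIntegers 3)) ^ ν * L₀) ^ e =
        (PowerSeries.C ((3 : ℕ) : unrIntegers 3)) ^ (s + ν * e) * L₀ ^ e := by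
      rw [mul_pow, ← pow_mul, pow_add]; ring
    rw [← e1, ← e2]; exact h
  -- the 3-free parts
  have hA : g₀ ^ e ∣ L₀ ^ e := by
    have h2 : g₀ ^ e ∣ (PowerSeries.C ((3 : ℕ) : unrIntegers 3)) ^ (s + ν * e) * L₀ ^ e :=
      (Dvd.intro_left _ rfl).trans h1
    exact dvd_of_dvd_prime_pow_mul hπ (fun hd ↦ hg₀ (hπ.dvd_of_dvd_pow hd)) _ h2
  have hA' : g₀ ∣ L₀ := by
    haveI : UniqueFactorizationMonoid (PowerSeries (unrIntegers 3)) :=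
      Summit.BirchSwinnertonDyer.BirchSwinnertonDyer.Theorems.TelescopeCarrierAlgOfWitness.uniqueFactorizationMonoid_unrSeries 3
    exact (IsIntegrallyClosed.pow_dvd_pow_iff he).mp hA
  -- the 3-parts: μ·e ≤ s + ν·e because 3^{μe} ∣ 3^{s+νe}·L₀^e with 3 ∤ L₀^e
  have hB : (PowerSeries.C ((3 : ℕ) : unrIntegers 3)) ^ (μ * e) ∣
      (PowerSeries.C ((3 : ℕ) : unrIntegers 3)) ^ (s + ν * e) := by
    have h3 : (PowerSeries.C ((3 : ℕ) : unrIntegers 3)) ^ (μ * e) ∣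
        (PowerSeries.C ((3 : ℕ) : unrIntegers 3)) ^ (s + ν * e) * L₀ ^ e := (Dvd.intro _ rfl).trans h1
    exact hπ.pow_dvd_of_dvd_mul_right _ (fun hd ↦ hL₀ (hπ.dvd_of_dvd_pow hd)) h3
  have hμν : μ ≤ ν := by
    have hle : μ * e ≤ s + ν * e := (pow_dvd_pow_iff hπ.ne_zero hπ.not_unit).mp hB
    have hlt : μ * e < (ν + 1) * e := by
      calc μ * e ≤ s + ν * e := hle
        _ < e + ν * e := by omega
        _ = (ν + 1) * e := by ring
    have := Nat.lt_of_mul_lt_mul_right hlt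
    omega
  exact mul_dvd_mul (pow_dvd_pow _ hμν) hA'

/-- The door at the level of principal ideals: `3^s · L^e ∈ (g)^e` with `s < e` gives `(L) ⊆ (g)`. [folklore] -/
theorem span_le_span_of_deficient {g L : UnrSeries 3} {e s : ℕ} (hse : s < e)
    (h : (PowerSeries.C ((3 : ℕ) : unrIntegers 3)) ^ s * L ^ e ∈ (Ideal.span ({g} : Set (UnrSeries 3))) ^ e) :
    Ideal.span ({L} : Set (UnrSeries 3)) ≤ Ideal.span {g} := by
  rw [Ideal.span_singleton_pow, Ideal.mem_span_singleton] at h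
  exact Ideal.span_singleton_le_span_singleton.mpr (dvd_of_pow_dvd_C_pow_mul_pow hse h)

/-- `Ch_Λ(X)·R₀⟦T⟧` is principal for every `Λ`-module (tree `charIdeal_isPrincipal_holds`, `Ideal.map_span`).
Verbatim node `mu_dominance_relative_teeth`. [Washington1997 §13.2] -/
theorem exists_map_charIdeal_eq_span (M : Type) [AddCommGroup M] [Module (IwasawaAlgebra 3) M] :
    ∃ g : UnrSeries 3,
      (Module.charIdeal (IwasawaAlgebra 3) M).map (PowerSeries.map (Halves.toUnr 3)) = Ideal.span {g} := by
  obtain ⟨f, hf⟩ := (charIdeal_isPrincipal_holds 3 M).principal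
  refine ⟨PowerSeries.map (Halves.toUnr 3) f, ?_⟩
  have hf' : Module.charIdeal (IwasawaAlgebra 3) M = Ideal.span {f} := hf
  rw [hf', Ideal.map_span, Set.image_singleton]

/-- `φ(3^{k+1}) = 2·3^k` exceeds `k`. [folklore] -/
theorem lt_totient_three_pow_succ (k : ℕ) : k < Nat.totient (3 ^ (k + 1)) := by
  rw [Nat.totient_prime_pow_succ Nat.prime_three]
  have h3 : k < 3 ^ k := Nat.lt_pow_self (by norm_num)
  omega

/-! ## §1 The cyclotomic teeth (verbatim nodes `toothwise_kolyvagin_mu`, `mu_dominance_relative_teeth`) -/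

/-- The `k`-th CYCLOTOMIC TOOTH `𝔮_k = Φ_{3^k}(1+T) ∈ Λ = ℤ₃⟦T⟧` (degree `φ(3^k)`, `Λ/𝔮_k ≅ ℤ₃[ζ_{3^k}]`).
[Washington1997 §7.1] -/
def tooth (k : ℕ) : IwasawaAlgebra 3 :=
  (((Polynomial.cyclotomic (3 ^ k) ℤ_[3]).comp (Polynomial.X + 1) : Polynomial ℤ_[3]) : PowerSeries ℤ_[3])

/-- The tooth read in the receptacle `R₀⟦T⟧` (`R₀⟦T⟧/(𝔮_k) ≅ R₀[ζ_{3^k}] = 𝒪_k`, totally ramified of degree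
`φ(3^k)` over `R₀`). [Castella2018 §2.2] -/
def toothUnr (k : ℕ) : UnrSeries 3 :=
  PowerSeries.map (Halves.toUnr 3) (tooth k)

/-- The `R₀⟦T⟧`-length of `R₀⟦T⟧/(𝔮_k, L)` = `v_{π_k}(L(ζ_{3^k} - 1))` (`⊤` iff `𝔮_k ∣ L`): the TOOTH VALUE of `L`
read WITHOUT an evaluation map. [Washington1997 §7.1] -/
abbrev toothLengthOf (L : UnrSeries 3) (k : ℕ) : ℕ∞ :=
  Module.length (UnrSeries 3) (UnrSeries 3 ⧸ Ideal.span ({toothUnr k, L} : Set (UnrSeries 3)))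

/-! ## §2 Pieces (Props) -/

/-- PIECE S1 — THE ARITHMETIC LEAF (UNDECIDED; idea card `Ideas/ramified-pin-evaporation.md`). EVAPORATING PINNED
POWER SUPPLY at additive split 3: at every wall frame (binders = the wall's, verbatim) there is a bound `B` such that
for every `m ≥ 1` some `3 ^ s · L ^ φ(3^m)` lies in `(Ch_Λ(X_(∅,0))·R₀⟦T⟧) ^ φ(3^m)` with
`s ≤ B + v_{π_m}(L(ζ_{3^m}-1))`. This is the NORMED-DOWN SHAPE of one `Λ_{𝒪_m}`-adic Kolyvagin-system divisibility
`char ∣ 3^a · C_m · φ_m · L` over `𝒪_m = R₀[ζ_{3^m}]` with pin `C_m` of valuation `v_{π_m}(L(ζ_{3^m}-1))` and TOTAL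
structural junk `a = 0`, `v_{π_m}(φ_m) ≤ B` (informal producer: the frozen-channel diagonal class of Castella–Do with
`f_E` frozen, specialised along `u = ζ_{3^m}-1`; sibling card 24207 `frozen-channel-padic-pin`). TRANSFER `C⁺`: implied
by the WALL with `B = s = 0` (`evaporatingPinSupply_of_wall`), and giving it back through the door once S2 ∧ S3 hold.
WHY IT MIGHT FAIL: a structural `3`-exponent `a ≥ 1` that does not shrink in `π_m`-units (Mazur–Rubin (H.4) needs
`p > 4`; exotic `3`-adic images, tree `GaloisImage/ExoticThreeAdicImage`; `3 ∣ c_3` for Kodaira IV/IV*), or no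
diagonal class at additive supercuspidal `3` (Castella–Do assume `p ∤ 6N_f`, `f` ordinary). [CastellaDo2023 Thm. A,
§5; MazurRubin2004 Thm. 5.2.10; Howard2004HeegnerKolyvagin Thm. 2.2.10] -/
def EvaporatingPinSupplyAtThree : Prop :=
  ∀ (W : WeierstrassCurve ℚ) [W.IsElliptic] [W.IsGloballyMinimal] (N : ℕ) [NeZero N] (K : Type) [Field K]
    [NumberField K] (Dt : Literature.NumberTheory.EllipticCurves.ModularForms.ModularParametrizationData W N),
    Summit.BirchSwinnertonDyer.Rank1Residual.Additive.ClassO6 W 3 → W.HasSurjectiveModNGaloisRep 3 →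
    W.analyticRank = 1 → W.conductorNorm ℤ = N → IsImaginaryQuadratic K → SatisfiesHeegnerHypothesis N K →
    ∀ (κ : ZpExtension K 3), κ.IsAnticyclotomic →
    ∀ (γ : Field.absoluteGaloisGroup K) [Fact (κ.IsTopGenerator γ)]
      (𝔭 : IsDedekindDomain.HeightOneSpectrum (NumberField.RingOfIntegers K)),
      ((3 : ℕ) : NumberField.RingOfIntegers K) ∈ 𝔭.asIdeal →
      𝔭.asIdeal.ramificationIdx (NumberField.RingOfIntegers ℚ) = 1 →
      𝔭.asIdeal.inertiaDeg (NumberField.RingOfIntegers ℚ) = 1 →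
      ∀ (𝔭' : IsDedekindDomain.HeightOneSpectrum (NumberField.RingOfIntegers K)),
        ((3 : ℕ) : NumberField.RingOfIntegers K) ∈ 𝔭'.asIdeal → 𝔭' ≠ 𝔭 →
        ∀ (ι' : PadicAlgCl 3 ≃+* ℂ),
          Summit.BirchSwinnertonDyer.BirchSwinnertonDyer.Theorems.SchneiderFree.BranchInducesPrime 3 ι' 𝔭 →
          ∀ (ΩK : ℂ) (Ωp : ℂ_[3]) (L : UnrSeries 3), ΩK ≠ 0 → Ωp ≠ 0 →
            IsBDPLFunction ι' 𝔭 κ γ Dt.f ΩK Ωp L →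
            ∃ B : ℕ, ∀ m : ℕ, 1 ≤ m →
              ∃ s : ℕ, (s : ℕ∞) ≤ (B : ℕ∞) + toothLengthOf L m ∧
                (PowerSeries.C ((3 : ℕ) : unrIntegers 3)) ^ s * L ^ Nat.totient (3 ^ m) ∈
                  ((AcSelmer.XAc.charIdeal (W.baseChange K) 3 κ 𝔭' ∅ γ).map
                      (PowerSeries.map (Halves.toUnr 3))) ^ Nat.totient (3 ^ m)

/-- PIECE S2 (ATTACKABLE, pure commutative algebra, TRUE): if `L ∈ R₀⟦T⟧` has a unit coefficient (`μ(L) = 0`,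
`L ≠ 0`), its tooth values are EVENTUALLY BOUNDED: `v_{π_m}(L(ζ_{3^m}-1)) ≤ n₀` for `m ≥ m₀` (indeed `= λ(L)` as soon
as `φ(3^m) > λ(L)` and `𝔮_m ∤ L`: Weierstrass preparation, `𝔮_m = Φ_{3^m}(1+T)` Eisenstein over `R₀`,
`R₀⟦T⟧/(𝔮_m) ≅ R₀[ζ_{3^m}]` a DVR with `v(ζ-1) = 1`, `v(3) = φ(3^m)`). [Washington1997 §7.1 Prop. 7.2, Thm. 7.3;
Lang1990 Cyclotomic Fields I–II Ch. 5 §2] -/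
def ToothLengthEventuallyBounded : Prop :=
  ∀ L : UnrSeries 3, (∃ i : ℕ, ‖((PowerSeries.coeff i L : unrIntegers 3) : ℂ_[3])‖ = 1) →
    ∃ n₀ m₀ : ℕ, ∀ m : ℕ, m₀ ≤ m → toothLengthOf L m ≤ (n₀ : ℕ∞)

/-- PIECE S3 (ATTACKABLE; analytic `μ = 0` of the BDP branch at additive split 3): at every wall frame the branch
`L = L_𝔭^{BDP}(f_E/K)` has a coefficient of norm `1`. Informal engine: Hsieh's Zariski-density / toric-orbit proof of
`μ = 0` (Hsieh 2014 Thm. B, Burungale 2017) applies to the `3`-DEPLETED form `f_E = f_E^{[3]}` (`a_{3k}(f_E) = 0` at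
additive `3`), a `p`-adic modular form of tame level `N/27`; nearest tree handle
`Hsieh2014.thmB_exists_isHsiehLFunction_coeff_norm_eq_one_unrPeriod_anyLevel`, route item 20456 (`HsiehAnyLevelInput`).
Same period exposure as the wall itself (frames whose `(Ω_K, Ω_p)` are not a CM pair carry no interpolating `L` or a
unit multiple of the canonical one). WHY IT MIGHT FAIL: the transfer Hsieh-`L` → BDP branch at `p ∣ N` costs a
non-unit (local factor at the additive prime). [Hsieh2014 Thm. B; Burungale2017; CastellaHsieh2018 Prop. 3.6] -/
def AnalyticMuZeroBDPBranchAtThree : Prop :=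
  ∀ (W : WeierstrassCurve ℚ) [W.IsElliptic] [W.IsGloballyMinimal] (N : ℕ) [NeZero N] (K : Type) [Field K]
    [NumberField K] (Dt : Literature.NumberTheory.EllipticCurves.ModularForms.ModularParametrizationData W N),
    Summit.BirchSwinnertonDyer.Rank1Residual.Additive.ClassO6 W 3 → W.HasSurjectiveModNGaloisRep 3 →
    W.analyticRank = 1 → W.conductorNorm ℤ = N → IsImaginaryQuadratic K → SatisfiesHeegnerHypothesis N K →
    ∀ (κ : ZpExtension K 3), κ.IsAnticyclotomic →
    ∀ (γ : Field.absoluteGaloisGroup K) [Fact (κ.IsTopGenerator γ)]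
      (𝔭 : IsDedekindDomain.HeightOneSpectrum (NumberField.RingOfIntegers K)),
      ((3 : ℕ) : NumberField.RingOfIntegers K) ∈ 𝔭.asIdeal →
      𝔭.asIdeal.ramificationIdx (NumberField.RingOfIntegers ℚ) = 1 →
      𝔭.asIdeal.inertiaDeg (NumberField.RingOfIntegers ℚ) = 1 →
      ∀ (𝔭' : IsDedekindDomain.HeightOneSpectrum (NumberField.RingOfIntegers K)),
        ((3 : ℕ) : NumberField.RingOfIntegers K) ∈ 𝔭'.asIdeal → 𝔭' ≠ 𝔭 →
        ∀ (ι' : PadicAlgCl 3 ≃+* ℂ),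
          Summit.BirchSwinnertonDyer.BirchSwinnertonDyer.Theorems.SchneiderFree.BranchInducesPrime 3 ι' 𝔭 →
          ∀ (ΩK : ℂ) (Ωp : ℂ_[3]) (L : UnrSeries 3), ΩK ≠ 0 → Ωp ≠ 0 →
            IsBDPLFunction ι' 𝔭 κ γ Dt.f ΩK Ωp L →
            ∃ i : ℕ, ‖((PowerSeries.coeff i L : unrIntegers 3) : ℂ_[3])‖ = 1

/-! ## §3 Registered stubs (the ONLY `sorry`s of this file) -/

/-- STUB S1 (UNDECIDED arithmetic leaf). -/
theorem stub_evaporatingPinSupply : EvaporatingPinSupplyAtThree := by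
  sorry

/-- STUB S2 (ATTACKABLE, pure algebra, M-sized). -/
theorem stub_toothLengthEventuallyBounded : ToothLengthEventuallyBounded := by
  sorry

/-- STUB S3 (ATTACKABLE, analytic μ = 0 of the branch). -/
theorem stub_analyticMuZero : AnalyticMuZeroBDPBranchAtThree := by
  sorry

/-! ## §4 The composition (kernel-checked, no `sorry`): S1 → S2 → S3 → THE WALL -/

/-- **The wall from an evaporating pinned power supply** (concludes the crux BY NAME). At a frame: `Ch·R₀⟦T⟧ = (g)`;
S3 gives a unit coefficient of `L`, S2 bounds the tooth values `≤ n₀` from `m₀` on, S1 gives `B`; at the tooth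
`m = m₀ + B + n₀ + 1` one has `3^s·L^e ∈ (g)^e` with `s ≤ B + n₀ < e = φ(3^m)`, and the §0 door gives `(L) ⊆ (g)`.
[folklore composition] -/
theorem AdditiveSplitIMCInclusionAtThree_of :
    EvaporatingPinSupplyAtThree → ToothLengthEventuallyBounded → AnalyticMuZeroBDPBranchAtThree →
      AdditiveSplitIMCInclusionAtThree := by
  intro hS hT hA W _ _ N _ K _ _ Dt hO6 hsurj hr1 hN hK hH κ hκ γ _ 𝔭 h3 he hf 𝔭' h3' hne ι' hι ΩK Ωp L hΩK hΩp hL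
  obtain ⟨B, hB⟩ := hS W N K Dt hO6 hsurj hr1 hN hK hH κ hκ γ 𝔭 h3 he hf 𝔭' h3' hne ι' hι ΩK Ωp L hΩK hΩp hL
  obtain ⟨n₀, m₀, hn₀⟩ :=
    hT L (hA W N K Dt hO6 hsurj hr1 hN hK hH κ hκ γ 𝔭 h3 he hf 𝔭' h3' hne ι' hι ΩK Ωp L hΩK hΩp hL)
  obtain ⟨g, hg⟩ := exists_map_charIdeal_eq_span (AcSelmer.XAc (W.baseChange K) 3 κ 𝔭' ∅ γ)
  have hg' : (AcSelmer.XAc.charIdeal (W.baseChange K) 3 κ 𝔭' ∅ γ).map (PowerSeries.map (Halves.toUnr 3)) =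
      Ideal.span {g} := hg
  -- the deep tooth
  obtain ⟨s, hs, hmem⟩ := hB (m₀ + B + n₀ + 1) (by omega)
  have hsle : (s : ℕ∞) ≤ (B : ℕ∞) + (n₀ : ℕ∞) :=
    hs.trans (add_le_add le_rfl (hn₀ (m₀ + B + n₀ + 1) (by omega)))
  have hsle' : s ≤ B + n₀ := by exact_mod_cast hsle
  have hse : s < Nat.totient (3 ^ (m₀ + B + n₀ + 1)) :=
    lt_of_le_of_lt hsle' (lt_of_le_of_lt (by omega) (lt_totient_three_pow_succ (m₀ + B + n₀)))
  rw [hg'] at hmem ⊢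
  exact span_le_span_of_deficient hse hmem

/-- Same composition from the registered stubs (audit: depends on the three `stub_*` sorries only). -/
theorem AdditiveSplitIMCInclusionAtThree_holds_of_stubs : AdditiveSplitIMCInclusionAtThree :=
  AdditiveSplitIMCInclusionAtThree_of stub_evaporatingPinSupply stub_toothLengthEventuallyBounded stub_analyticMuZero

/-! ## §5 Tags (kernel-checked) -/

/-- Tag TRANSFER for S1: THE WALL ⟹ S1 (take `B = 0`, `s = 0`: `L ∈ Ch·R₀⟦T⟧` gives `L^e ∈ (Ch·R₀⟦T⟧)^e`). So S1 is
NOT weaker than the crux in isolation; it is the crux's OUTPUT SHAPE WITH SLACK, equivalent to it exactly when S2 ∧ S3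
hold (`AdditiveSplitIMCInclusionAtThree_of`). -/
theorem evaporatingPinSupply_of_wall : AdditiveSplitIMCInclusionAtThree → EvaporatingPinSupplyAtThree := by
  intro hW W _ _ N _ K _ _ Dt hO6 hsurj hr1 hN hK hH κ hκ γ _ 𝔭 h3 he hf 𝔭' h3' hne ι' hι ΩK Ωp L hΩK hΩp hL
  have h := hW W N K Dt hO6 hsurj hr1 hN hK hH κ hκ γ 𝔭 h3 he hf 𝔭' h3' hne ι' hι ΩK Ωp L hΩK hΩp hL
  refine ⟨0, fun m _ ↦ ⟨0, by simp, ?_⟩⟩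
  rw [pow_zero, one_mul]
  exact Ideal.pow_mem_pow (h (Ideal.subset_span (Set.mem_singleton L))) _

/-- The door is SHARP in the exponent: with `s = e` nothing follows (`g = 3`, `L = 1`, `e = s = 1`:
`3 ∣ 3·1` but `3 ∤ 1`). Recorded as the statement that the hypothesis `s < e` cannot be weakened to `s ≤ e`. -/
theorem door_sharp : ∃ (g L : UnrSeries 3) (e s : ℕ), s ≤ e ∧
    g ^ e ∣ (PowerSeries.C ((3 : ℕ) : unrIntegers 3)) ^ s * L ^ e ∧ ¬ g ∣ L := by
  refine ⟨PowerSeries.C ((3 : ℕ) : unrIntegers 3), 1, 1, 1, le_rfl, by simp, ?_⟩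
  rw [← isUnit_iff_dvd_one]
  exact prime_C_three.not_unit

end Summit.BirchSwinnertonDyer.BirchSwinnertonDyer.Cruxes.AdditiveSplitIMCInclusionAtThree.RamifiedPinEvaporation

end
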